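import Summits.HubbardSuperconductivity.HubbardSuperconductivity.Theorems.AnisotropyChordTransferTolerance
import Summits.HubbardSuperconductivity.HubbardSuperconductivity.Theorems.AnisotropyChordTransferCompressibilityResponse
import Summits.HubbardSuperconductivity.HubbardSuperconductivity.Theorems.AnisotropyChordTransferSectorZeroGround
import Summits.HubbardSuperconductivity.HubbardSuperconductivity.Theorems.AnisotropyChordTransferLadderBound

/-!
# Route `AnisotropyChord` / H0 rotor rung, route (1): THE RESPONSE CURRENCY, FIRST LINK — a `k = 0` order-parameter response
# `Ξ ≤ ξ|V|` of the half-filled sector already gives BEC one particle above half filling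
# (theory seat `hubbard-h0-rotor-theory-1` g12, memo ROTOR-THEORY-12 §184(b) «T is bookable in three currencies», cell INBOX l.481 (2c);
# prover seat `hubbard-h0-rotor-p1` g15)

The tree has the response-form transfer bound `raised_one_sub_fidelity_sq_le` (`(1 − F)² ≤ Ξ·η̂`, `Ξ` = HYPOTHESIS
`RaisedResponseBound`, `η̂ = ⟨Φ̂, HΦ̂⟩ − E(1)`, `Φ̂ = S⁺ψ₀/‖S⁺ψ₀‖`) and the tolerance form of THEOREM T
(`condensateOnFirstSectors_of_fidelityDefect`).  On the FIRST link the excess is controlled by tree theorems alone: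
LEMMA E (`ladderExcessBound_holds`) + (H3-even) (`sectorZeroGlobalGroundEven_holds`) + the variational floor at the sector `−1`
give `⟨S⁺ψ₀,(H − E(1))S⁺ψ₀⟩ ≤ 4(1−Δ)|V|`, and the anchor gives `‖S⁺ψ₀‖² ≥ c₀|V|²`, so `η̂ ≤ 4(1−Δ)/(c₀|V|)` and

* **`towerFidelityDefect_one_of_response`** — `RaisedResponseBound Δ 0 (ξ|V|)` eventually ⇒ `TowerFidelityDefect Δ √(4(1−Δ)ξ/c₀) 1`;
* **`condensate_sectorOne_of_response`** — `0 ≤ Δ < 1`, anchor `0 < c₀ ≤ 1`, `4(1−Δ)ξ < c₀³` ⇒ `CondensateOnFirstSectors Δ 1`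
  (BEC at `N = L²/2` and `N = L²/2 + 1`): the response may grow like `ξ|V|` — the `1/|V|` = SEP scale again (`Ξ ≤ 1/γ_sym`), cf.
  `condensateOnFirstSectors_of_gapInvV`.

All folklore-level bookkeeping on landed theorems; the hypothesis `RaisedResponseBound` stays OPEN.
-/

set_option linter.dupNamespace false
set_option autoImplicit false

noncomputable section

open Finset Filter Topology
open Literature.MathematicalPhysics.QuantumLattice Literature.Probability.LatticeModels
open Summit.HubbardSuperconductivity.HubbardSuperconductivity.Theorems.AnisotropyChord.InsertionEntropy
open Summit.HubbardSuperconductivity.HubbardSuperconductivity.Theorems.AnisotropyChord.Tower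
open Summit.HubbardSuperconductivity.HubbardSuperconductivity.Theorems.AnisotropyChord

namespace Summit.HubbardSuperconductivity.HubbardSuperconductivity.Theorems.AnisotropyChord.Transfer

variable {L : ℕ} [NeZero L]

/-- **first-link excess bound:** for the sector-`0` Perron amplitude `b` of `H(Δ)` on an even torus, `0 ≤ Δ < 1`:
`⟨S⁺b, H S⁺b⟩ − E(1)‖S⁺b‖² ≤ 4(1−Δ)L²` (LEMMA E + `E(0) ≤ E(1)`, `E(0) ≤ E(−1)` by (H3-even) + the variational floor of `S⁻b`). [folklore] -/
theorem raise_excess_le_of_sectorZero {Δ : ℝ} (hΔ0 : 0 ≤ Δ) (hΔ1 : Δ < 1) (hL : 2 ≤ L)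
    {b a : TensorIndex (TorusSite 2 L) 2 → ℝ} (hb : IsPerronSectorGroundAmplitude L Δ 0 b)
    (ha : IsPerronSectorGroundAmplitude L Δ (0 + 1) a) :
    energyQ L Δ (raiseSum b) - sectorE L Δ (0 + 1) * raiseNormSq b ≤ 4 * (1 - Δ) * (L : ℝ) ^ 2 := by
  have hev : Even L := by
    have h0 : IsPerronSectorGroundAmplitude L Δ ((0 : ℕ) : ℝ) b := by rw [Nat.cast_zero]; exact hb
    exact even_of_perron_nat h0
  have hGlob := sectorZeroGlobalGroundEven_holds (abs_lt.2 ⟨by linarith, hΔ1⟩)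
  have hE01 : sectorE L Δ 0 ≤ sectorE L Δ (0 + 1) := hGlob L hev (0 + 1) a ha
  obtain ⟨bm, hbm⟩ := exists_perron_neg_one hb (le_trans hL (Nat.le_self_pow two_ne_zero L))
  have hE0m : sectorE L Δ 0 ≤ sectorE L Δ (-1) := hGlob L hev (-1) bm hbm
  have hLE := ladderExcessBound_holds L Δ 0 hΔ1.le b hb
  have hdown := sectorE_pred_mul_le hb
  rw [show (0 : ℝ) - 1 = -1 by norm_num] at hdown
  have hN0 : 0 ≤ raiseNormSq b := Finset.sum_nonneg fun σ _ => sq_nonneg _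
  have hNt0 : 0 ≤ lowerNormSq b := Finset.sum_nonneg fun τ _ => sq_nonneg _
  nlinarith [mul_le_mul_of_nonneg_right hE01 hN0, mul_le_mul_of_nonneg_right hE0m hNt0]

/-- the normalised raised vector of a Perron amplitude with `S⁺b ≠ 0`: in the next sector, unit, fidelity `towerFidelity b a`,
energy `⟨S⁺b, H S⁺b⟩/‖S⁺b‖²`. [folklore] -/
theorem raisedUnit_facts {Δ M : ℝ} {b : TensorIndex (TorusSite 2 L) 2 → ℝ} (hb : IsPerronSectorGroundAmplitude L Δ M b)
    (hN : 0 < raiseNormSq b) (a : TensorIndex (TorusSite 2 L) 2 → ℝ) :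
    cplx L (raisedUnit b) ∈ spinZSector (Λ := TorusSite 2 L) 1 (M + 1) ∧ ∑ σ, raisedUnit b σ ^ 2 = 1 ∧
      (∑ σ, a σ * raisedUnit b σ) ^ 2 = towerFidelity b a ∧
      energyQ L Δ (raisedUnit b) = energyQ L Δ (raiseSum b) / raiseNormSq b := by
  set s : ℝ := (Real.sqrt (raiseNormSq b))⁻¹ with hs
  have hs2 : s ^ 2 * raiseNormSq b = 1 := by
    rw [hs, inv_pow, Real.sq_sqrt hN.le, inv_mul_cancel₀ hN.ne']
  have hunitσ : ∀ σ, raisedUnit b σ = s * raiseSum b σ := fun σ => by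
    unfold raisedUnit; rw [hs, div_eq_mul_inv, mul_comm]
  have heq : raisedUnit b = s • raiseSum b := by funext σ; rw [hunitσ, Pi.smul_apply, smul_eq_mul]
  refine ⟨?_, ?_, ?_, ?_⟩
  · have h0 := mem_spinZSector_of_support (M + 1) (raiseSum b) (raiseSum_support_perron hb)
    have e : cplx L (raisedUnit b) = (s : ℂ) • (fun τ => (raiseSum b τ : ℂ)) := by
      funext σ; simp [cplx, hunitσ]
    rw [e]; exact Submodule.smul_mem _ _ h0
  · simp only [hunitσ, mul_pow]
    rw [← Finset.mul_sum]; exact hs2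
  · have e1 : ∑ σ, a σ * raisedUnit b σ = s * towerSum b a := by
      simp only [hunitσ]
      rw [← sum_mul_raiseSum_eq_towerSum, Finset.mul_sum]
      exact Finset.sum_congr rfl fun σ _ => by ring
    rw [e1, mul_pow]
    unfold towerFidelity
    rw [eq_div_iff hN.ne']
    calc s ^ 2 * towerSum b a ^ 2 * raiseNormSq b = towerSum b a ^ 2 * (s ^ 2 * raiseNormSq b) := by ring
      _ = towerSum b a ^ 2 := by rw [hs2, mul_one]
  · rw [heq, energyQ_smul, eq_div_iff hN.ne']
    calc s ^ 2 * energyQ L Δ (raiseSum b) * raiseNormSq b = energyQ L Δ (raiseSum b) * (s ^ 2 * raiseNormSq b) := by ring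
      _ = energyQ L Δ (raiseSum b) := by rw [hs2, mul_one]

/-- **RESPONSE ⇒ FIRST-LINK FIDELITY DEFECT:** `0 ≤ Δ < 1`, anchor `c₀ > 0`, and eventually in `L` the tower-removed `k = 0` response of
the half-filled sector obeys `RaisedResponseBound Δ 0 (ξ|V|)` ⇒ `TowerFidelityDefect Δ √(4(1−Δ)ξ/c₀) 1`
(`(1 − F₀)² ≤ Ξ·η̂₀ ≤ ξ|V|·4(1−Δ)/(c₀|V|)`). [conjecture: theory seat hubbard-h0-rotor-theory-1, cycle 12, memo §184(b) response currency — Lean proof here] -/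
theorem towerFidelityDefect_one_of_response {Δ c₀ ξ : ℝ} (hΔ0 : 0 ≤ Δ) (hΔ1 : Δ < 1) (hc₀ : 0 < c₀) (hξ0 : 0 ≤ ξ)
    (hA : HalfFillingAnchor Δ c₀)
    (hΞ : ∀ᶠ L : ℕ in atTop, ∀ [NeZero L], RaisedResponseBound (L := L) Δ 0 (ξ * (Fintype.card (TorusSite 2 L) : ℝ))) :
    TowerFidelityDefect Δ (Real.sqrt (4 * (1 - Δ) * ξ / c₀)) 1 := by
  have hT : ∀ᶠ L : ℕ in atTop, 2 ≤ L := Filter.eventually_ge_atTop _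
  filter_upwards [hA, hΞ, hT] with L hAL hΞL hL2
  intro _ j hj b a hb ha
  have hj0 : j = 0 := by omega
  subst hj0
  rw [Nat.cast_zero] at hb ha
  set V : ℝ := (Fintype.card (TorusSite 2 L) : ℝ) with hVdef
  have hV : V = (L : ℝ) ^ 2 := by rw [hVdef, Fintype.card_fun, ZMod.card, Fintype.card_fin]; push_cast; ring
  have hVpos : 0 < V := by rw [hVdef]; exact_mod_cast Fintype.card_pos
  -- ‖S⁺b‖² = ‖S⁻b‖² ≥ c₀ V²  (anchor)
  have hN : raiseNormSq b = lowerNormSq b := by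
    rw [raiseNormSq_eq_totalSpinSq hb, lowerNormSq_eq_totalSpinSq 0 b]; ring
  have hanchor : c₀ * V ^ 2 ≤ raiseNormSq b := by
    have h := hAL b hb
    have e : condensateDensity b = lowerNormSq b / V ^ 2 := by rw [hVdef]; rfl
    rw [e, le_div_iff₀ (by positivity)] at h
    rw [hN]; exact h
  have hNpos : 0 < raiseNormSq b := lt_of_lt_of_le (by positivity) hanchor
  obtain ⟨hmem, hunit, hfid, henergy⟩ := raisedUnit_facts hb hNpos a
  -- the response-form transfer bound
  have hresp := raised_one_sub_fidelity_sq_le hΞL hb ha hmem hunit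
  rw [hfid, henergy] at hresp
  -- the excess of the normalised raised vector
  have hexc := raise_excess_le_of_sectorZero hΔ0 hΔ1 hL2 hb ha
  have hη : energyQ L Δ (raiseSum b) / raiseNormSq b - sectorE L Δ (0 + 1) ≤ 4 * (1 - Δ) / (c₀ * V) := by
    rw [div_sub' hNpos.ne', div_le_div_iff₀ hNpos (by positivity)]
    calc (energyQ L Δ (raiseSum b) - raiseNormSq b * sectorE L Δ (0 + 1)) * (c₀ * V)
        ≤ (4 * (1 - Δ) * (L : ℝ) ^ 2) * (c₀ * V) := by
          apply mul_le_mul_of_nonneg_right _ (by positivity); linarith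
      _ = 4 * (1 - Δ) * (c₀ * V ^ 2) := by rw [← hV]; ring
      _ ≤ 4 * (1 - Δ) * raiseNormSq b := mul_le_mul_of_nonneg_left hanchor (by linarith)
  have hΞnn : 0 ≤ ξ * V := by positivity
  have h1F : 0 ≤ 1 - towerFidelity b a := by
    have := towerFidelity_le b a; rw [ha.unit] at this; linarith
  have hsq : (1 - towerFidelity b a) ^ 2 ≤ 4 * (1 - Δ) * ξ / c₀ :=
    calc (1 - towerFidelity b a) ^ 2
        ≤ ξ * V * (energyQ L Δ (raiseSum b) / raiseNormSq b - sectorE L Δ (0 + 1)) := hresp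
      _ ≤ ξ * V * (4 * (1 - Δ) / (c₀ * V)) := mul_le_mul_of_nonneg_left hη hΞnn
      _ = 4 * (1 - Δ) * ξ / c₀ := by field_simp
  have hy : 0 ≤ 4 * (1 - Δ) * ξ / c₀ := div_nonneg (mul_nonneg (mul_nonneg (by norm_num) (by linarith)) hξ0) hc₀.le
  exact (Real.le_sqrt h1F hy).2 hsq

/-- **THE RESPONSE CURRENCY, FIRST LINK ⇒ BEC:** `0 ≤ Δ < 1`, anchor `0 < c₀ ≤ 1` (`c₀ ≤ 1` is automatic for a condensate density),
and `RaisedResponseBound Δ 0 (ξ|V|)` eventually in `L` with `4(1−Δ)ξ < c₀³` ⇒ `CondensateOnFirstSectors Δ 1`: BEC at `N = L²/2` AND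
`N = L²/2 + 1`.  The admissible response grows like `|V|` — the SEP / `1/|V|`-gap scale (`Ξ ≤ 1/γ_sym`), the response twin of
`condensateOnFirstSectors_of_gapInvV`. [conjecture: theory seat hubbard-h0-rotor-theory-1, cycle 12, memo §184(b); Lean proof here] -/
theorem condensate_sectorOne_of_response {Δ c₀ ξ : ℝ} (hΔ0 : 0 ≤ Δ) (hΔ1 : Δ < 1) (hc₀ : 0 < c₀) (hc₁ : c₀ ≤ 1)
    (hξ0 : 0 ≤ ξ) (hξ : 4 * (1 - Δ) * ξ < c₀ ^ 3) (hA : HalfFillingAnchor Δ c₀)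
    (hΞ : ∀ᶠ L : ℕ in atTop, ∀ [NeZero L], RaisedResponseBound (L := L) Δ 0 (ξ * (Fintype.card (TorusSite 2 L) : ℝ))) :
    CondensateOnFirstSectors Δ 1 := by
  set δ := Real.sqrt (4 * (1 - Δ) * ξ / c₀) with hδ
  have hδ0 : 0 ≤ δ := Real.sqrt_nonneg _
  have hδc : δ < c₀ := by
    rw [hδ, Real.sqrt_lt' hc₀, div_lt_iff₀ hc₀]
    nlinarith
  refine condensateOnFirstSectors_of_fidelityDefect hc₀ hδ0 (lt_of_lt_of_le hδc hc₁) (by simpa using hδc) hA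
    (towerFidelityDefect_one_of_response hΔ0 hΔ1 hc₀ hξ0 hA hΞ)

end Summit.HubbardSuperconductivity.HubbardSuperconductivity.Theorems.AnisotropyChord.Transfer
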